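import Summits.AtomisticToContinuum.HydrodynamicLimit.Theses.EulerCharacteristics
import Literature.MathematicalPhysics.KineticTheory.HardSphereTwoTimePressure

/-!
# Birth skeleton for the crux `FKTransferInProbR` (stmt-AtomisticToContinuum-18039)

Route `EulerCharacteristics` (sub-problem `HydrodynamicLimit`), crux rank 8:

  `FKTransferInProbR := ExpSecondLaw → ExponentialCellProblem → TailBudget → NoDenseInclusions → HydroLimitInBand`

("the Feng–Kurtz half in probability currency, repaired", rev 5). This file is the BC3 birth
skeleton (registrar one-shot, 2026-08-17): five NAMED stubs (`Holds.stub_*`, bodies `sorry`) whose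
statements, BY NAME (`stub_* : Prop := type_of% Holds.stub_*`, D-0027 §3.3 shape), imply the crux
through the sorry-free composition `FKTransferInProbR_of`, which concludes
`Summit.AtomisticToContinuum.HydrodynamicLimit.Theses.EulerCharacteristics.FKTransferInProbR` by name.

## The cut (the route's own TWO-LAYER PLAN for this node, PathConsistency → BlockStatics →
EntropicCharacteristics, typed; plus the field read-out and the entropy input made explicit)

Intermediate notions (all over existing declarations; `P` a family of laws on phase space):
* `PathConsistentAt P Φ η₀c t` — PATH CONSISTENCY on `[0,t]` at packing cap `η₀c`: for every pair
  of smooth tests and every `δ > 0` there is a tail threshold `A > 0` with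
  `P_N{some window [s,s+τ_N], s ∈ [0,t], has momentum- or energy-closure defect > δτ_N ∨ the cubic
  velocity tail above A exceeds δ at some r ≤ t+τ_N ∨ some ball of radius ℓ_N is packed above η₀c
  at some r ≤ t+τ_N} → 0` (windows, ball kernel, block fields, Euler fluxes with `p = hsPressure`
  and the two weak-form defects written EXACTLY as in `ExponentialCellProblem`, stmt-14606).
* `L2TrackingAt P Φ ρ u θ t` — the ball-averaged conserved fields at time `t` are `L²(𝕋³)`-close to
  `(ρ, ρu, E)(t)` in `P_N`-probability (at `t = 0` this is BLOCK STATICS).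
* `SecondLawSupAt P Φ t` — the block-resolution second law in SUP form on `[0,t]`, in probability
  (block entropy functional = the `ηB` of `ExpSecondLaw`, stmt-14608, verbatim up to unfolding).

Stubs (sizes are guesses):
1. `stub_pathConsistency` (M–L) — (ii) of the crux text: `ExponentialCellProblem → TailBudget →
   NoDenseInclusions → ∃ η̄ > 0 ∀ η₀c ∈ (0, η̄] ∀ profiles ∃ σ₀ ∀ σ < σ₀ ∀ band-η₀c/2 classical
   solutions ∀ Φ, LLN at 0 ⇒ ∀ t < T, PathConsistentAt LG Φ η₀c t`. Uses the PROVED statics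
   `TransferInequality_holds` (Cauchy–Schwarz transfer `LG(S) ≤ (e^{C(N+1)} G(S))^{1/2}`, `M := C+2`)
   and `GibbsInvariance_holds`; the cell threshold may be shrunk (the guarded event only shrinks),
   hence the `∀ η₀c ≤ η̄` form; union over a polynomial grid of window starts + a pathwise modulus in
   `s`; `TailBudget` at `ηb := η₀c/2`, `NoDenseInclusions` at `η₁ := η₀c`, both at `t' := (t+T)/2`.
2. `stub_blockStatics` (L) — block LLN at `t = 0` at scale `ℓ_N = (N+1)^{-1/4}` under local Gibbs
   laws: `L2TrackingAt LG Φ ρ u θ 0` for every classical solution whose `t = 0` fields are the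
   macroscopic LLN limit (static low-activity concentration at vanishing radius; beyond the proved
   macroscopic `localGibbs_lln`).
3. `stub_secondLawSup` (L) — the SUP-IN-TIME block second law under local Gibbs laws, in
   probability. FINDING recorded for the tenure planner: the crux antecedent `ExpSecondLaw` is typed
   POINTWISE in `r` with `r`-dependent constants (`∀ r ∃ c ∀ᶠ N`), which controls entropy dips only
   on `N`-independent finite time grids; the relative-entropy Gronwall of stub 4 integrates the flux
   remainder over ALL intermediate times and needs `sup_{r ≤ t}`. The SAME mechanism (Liouville
   invariance of `G` + explicit tilt + static block LD; `G(U(r) ≈ W) = G(U(0) ≈ W)` is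
   `r`-independent) gives the bound uniformly in `r`, and a pathwise dip-persistence modulus
   (`|d/dr ∫ηB| ≲ N^{1/4}`) upgrades a uniform exponential bound to the sup form. Hence `hS :
   ExpSecondLaw` is NOT consumed by `FKTransferInProbR_of` (it is the pointwise shadow of stub 3);
   recommendation: restate `ExpSecondLaw` in sup/uniform form at the next tenure pass, after which
   `hS` feeds stub 4 directly and stub 3 disappears.
4. `stub_entropicCharacteristics` (L, THE LEVER) — ENTROPY SELECTION + finite-`N` Dafermos /
   Březina–Feireisl relative-entropy Gronwall on the capped dilute branch: for EVERY family of laws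
   `P_N` carried by the good sets, sup-form second law + path consistency at cap `η₀c ≤ ηs` (`ηs`
   inside the EOS analyticity/convexity band, from `HsEosLowDensity_holds`) + `L²` tracking at
   `t = 0` ⇒ `L²` tracking at every `t < T`, for band-`η₀c/2` classical solutions. Deterministic on
   the good event + union bounds (monotonicity/subadditivity of outer measure only), hence `∀ P`.
5. `stub_fieldsOfTracking` (M) — read-out: `L²` tracking at `t` ⇒ `TendstoHydroFieldsAt P Φ ρ u θ t`
   (Cauchy–Schwarz in `x`, uniform continuity of the test `χ`, raw-vs-ball mismatch `ω_χ(ℓ_N)`,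
   kinetic-energy bound from the energy component).

`FKTransferInProbR_of`: `η₀(HLIB) := min η̄ ηs / 2`, `σ₀ := min σ₁ (min σ₂ σ₃)`, laws
`P_N := localGibbsLaw σ a₀ u₀ θ₀ N (Φ N)` (carried by the good sets:
`localGibbsLaw_absolutelyContinuous` + `measure_compl_good`), then 1 → (2, 3) → 4 → 5.

BC3 (2026-08-17, farm): `lean check --json` rc 0, sorries 5 = the five `Holds.stub_*`, zero elsewhere;
probes `stub → FKTransferInProbR` and `stub → _root_.HydrodynamicLimit` by `exact?` / `aesop` /
`simpa [stub]` / `unfold stub; simpa` FAIL for all five stubs (40/40 examples error: `exact?` could not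
close the goal ×10, aesop exhaustive-search failure ×10, simp leaves the goal / heartbeat timeout ×20).

Disproof used: none relevant (no `Cruxes/FKTransferInProbR/Disproof.lean` exists at registration).
Negatives checked: `EulerCharacteristicsExpTailBudget_refuted` (stmt-14607: no exponential currency
for cubic tails) — every tail statement here is in probability; no stub is an instance of a
statement in `ledger negatives --problem AtomisticToContinuum` (20 entries, 2026-08-17).
-/

noncomputable section

open MeasureTheory Filter Set Topology
open scoped ENNReal BigOperators Classical

namespace Summit.AtomisticToContinuum.HydrodynamicLimit.Cruxes.FKTransferInProbR.Birth

open Literature.MathematicalPhysics.KineticTheory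
open Summit.AtomisticToContinuum.HydrodynamicLimit.Theses.EulerCharacteristics

/-! ## Types and scales (the crux's) -/

/-- Phase space of `N + 1` spheres on `𝕋³`. -/
abbrev Cfg (N : ℕ) : Type := Literature.Analysis.FluidPDE.Config (N + 1) (Fin 3) T3

/-- A hard-sphere flow of `N + 1` spheres of diameter `hsDiameter σ N = σ (N+1)^{-1/3}` on `𝕋³`. -/
abbrev Flow (σ : ℝ) (N : ℕ) : Type :=
  Literature.Analysis.FluidPDE.HardSphereFlow (Literature.Analysis.FluidPDE.Torus.geometry (Fin 3))
    (hsDiameter σ N) (N + 1)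

/-- Families of flows (the crux's `Φ`). -/
abbrev Flows (σ : ℝ) : Type := (N : ℕ) → Flow σ N

/-- Families of laws on phase space (`P N` a measure on `Cfg N`; in the crux `P N = localGibbsLaw …`). -/
abbrev Laws : Type := (N : ℕ) → Measure (Cfg N)

/-- Block radius `ℓ_N = (N+1)^{-1/4}` (as in stmt-14606/14019/14425/14608). -/
def ell (N : ℕ) : ℝ := ((N + 1 : ℕ) : ℝ) ^ (-(1 / 4 : ℝ))

/-- Mesoscopic window length `τ_N = (N+1)^{-1/12}` (as in stmt-14606). -/
def tau (N : ℕ) : ℝ := ((N + 1 : ℕ) : ℝ) ^ (-(1 / 12 : ℝ))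

/-- The sharp normalised ball kernel `χ_N(x, y) = 1(dist(x,y) < ℓ_N)/|B_{ℓ_N}|`, written exactly as
inline in the route items. -/
def ballKernel (N : ℕ) (x y : T3) : ℝ :=
  if Literature.Analysis.FluidPDE.Torus.euclidDist x y < ell N then (4 / 3 * Real.pi * ell N ^ 3)⁻¹ else 0

variable {N : ℕ}

/-- Ball-averaged empirical density `ρ^ℓ_N(x)`. -/
def bρ (z : Cfg N) (x : T3) : ℝ := empiricalDensityField z (ballKernel N x)
/-- Ball-averaged empirical momentum `m^ℓ_N(x)`. -/
def bm (z : Cfg N) (x : T3) : V3 := empiricalMomentumField z (ballKernel N x)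
/-- Ball-averaged empirical energy `e^ℓ_N(x)`. -/
def be (z : Cfg N) (x : T3) : ℝ := empiricalEnergyField z (ballKernel N x)
/-- Block temperature `θ^ℓ = (2/3)(e/ρ − |m|²/(2ρ²))` (junk `0`-divisions off the populated balls,
as in the route items). -/
def bθ (z : Cfg N) (x : T3) : ℝ := 2 / 3 * (be z x / bρ z x - ‖bm z x‖ ^ 2 / (2 * bρ z x ^ 2))
/-- Block pressure `p^ℓ = hsPressure σ ρ^ℓ θ^ℓ`. -/
def bp (σ : ℝ) (z : Cfg N) (x : T3) : ℝ := hsPressure σ (bρ z x) (bθ z x)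

/-- Cubic velocity tail above `A`: `(N+1)⁻¹ Σ_i (1 + |v_i|³) 1(|v_i| > A)` (as in stmt-14606/14019). -/
def cubicTail (A : ℝ) (z : Cfg N) : ℝ :=
  ∫ y, (1 + ‖y.2‖ ^ 3) * (if A < ‖y.2‖ then (1 : ℝ) else 0)
    ∂Literature.Analysis.FluidPDE.empiricalMeasure z

/-- Time-integrated weak-form MOMENTUM closure defect of a phase-space path `U` over the window
`[s, s+τ]`, against a vector test `ψ` smooth on `[0, S+1]`, Euler flux `m⊗m/ρ + p𝟙` of the
ball-averaged fields (the `Dmom` of stmt-14606, verbatim up to unfolding). -/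
def momDefect (U : ℝ → Cfg N) (σ S : ℝ) (ψ : ℝ → T3 → V3) (s τ : ℝ) : ℝ :=
  (∑ j, (empiricalMomentumField (U (s + τ)) (fun y => ψ (s + τ) y j)) j)
    - (∑ j, (empiricalMomentumField (U s) (fun y => ψ s y j)) j)
    - ∫ r in s..(s + τ), ((∑ j, (empiricalMomentumField (U r)
        (fun y => Literature.Analysis.FunctionSpaces.Torus.timeDerivWithin (Icc 0 (S + 1)) ψ r y j)) j)
      + ∫ x, ((∑ i, ∑ j, (Literature.Analysis.FunctionSpaces.Torus.partialDeriv i (ψ r) x) j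
          * (bm (U r) x i * bm (U r) x j / bρ (U r) x))
        + bp σ (U r) x * Literature.Analysis.FunctionSpaces.Torus.divergence (ψ r) x))

/-- Time-integrated weak-form ENERGY closure defect over `[s, s+τ]`, against a scalar test `φ`
smooth on `[0, S+1]`, Euler flux `(e+p)m/ρ` of the ball-averaged fields (the `Den` of stmt-14606). -/
def enDefect (U : ℝ → Cfg N) (σ S : ℝ) (φ : ℝ → T3 → ℝ) (s τ : ℝ) : ℝ :=
  empiricalEnergyField (U (s + τ)) (φ (s + τ)) - empiricalEnergyField (U s) (φ s)
    - ∫ r in s..(s + τ), (empiricalEnergyField (U r)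
        (Literature.Analysis.FunctionSpaces.Torus.timeDerivWithin (Icc 0 (S + 1)) φ r)
      + ∫ x, (be (U r) x + bp σ (U r) x)
          * (∑ i, (bm (U r) x i / bρ (U r) x) * (Literature.Analysis.FunctionSpaces.Torus.gradient (φ r) x) i))

/-- Block mathematical entropy density `η_σ(U^ℓ(x)) = −ρ(3/2 log θ − log ρ − F_ex(ρσ³))` (the `ηB`
of stmt-14608 / stmt-14427, verbatim up to unfolding). -/
def blockEta (σ : ℝ) (z : Cfg N) (x : T3) : ℝ :=
  -(bρ z x * (3 / 2 * Real.log (2 / 3 * (be z x / bρ z x - ‖bm z x‖ ^ 2 / (2 * bρ z x ^ 2)))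
    - Real.log (bρ z x) - hsExcessFreeEnergy (bρ z x * σ ^ 3)))

/-- Block entropy `∫ η_σ(U^ℓ_N(x)) dx`. -/
def blockEntropy (σ : ℝ) (z : Cfg N) : ℝ := ∫ x, blockEta σ z x

/-! ## The three intermediate notions -/

/-- PATH CONSISTENCY on `[0, t]` at packing cap `η₀c` under the laws `P` (conclusion of stub 1,
hypothesis of stub 4): for all tests `ψ` (vector) and `φ` (scalar) smooth on `[0, t+1]` and every
`δ > 0` there is `A > 0` such that the `P_N`-probability of
{some window `[s, s+τ_N]`, `s ∈ [0,t]`, has `|Dmom| > δτ_N` or `|Den| > δτ_N`} ∪ {the cubic tail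
above `A` exceeds `δ` at some `r ∈ [0, t+τ_N]`} ∪ {some ball is packed above `η₀c` at some
`r ∈ [0, t+τ_N]`} tends to `0`. -/
def PathConsistentAt (P : Laws) {σ : ℝ} (Φ : Flows σ) (η₀c t : ℝ) : Prop :=
  ∀ (ψ : ℝ → T3 → V3) (φ : ℝ → T3 → ℝ),
    Literature.Analysis.FunctionSpaces.Torus.IsSmoothSpaceTimeOn (Icc 0 (t + 1)) ψ →
    Literature.Analysis.FunctionSpaces.Torus.IsSmoothSpaceTimeOn (Icc 0 (t + 1)) φ →
    ∀ δ : ℝ, 0 < δ → ∃ A : ℝ, 0 < A ∧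
      Tendsto (fun N : ℕ => P N
        {z | (∃ s ∈ Icc 0 t,
                δ * tau N < |momDefect (fun r => (Φ N).flow r z) σ t ψ s (tau N)| ∨
                δ * tau N < |enDefect (fun r => (Φ N).flow r z) σ t φ s (tau N)|) ∨
             (∃ r ∈ Icc 0 (t + tau N), δ < cubicTail A ((Φ N).flow r z)) ∨
             (∃ r ∈ Icc 0 (t + tau N), ∃ x : T3, η₀c < bρ ((Φ N).flow r z) x * σ ^ 3)})
        atTop (𝓝 0)

/-- `L²` TRACKING at time `t` under the laws `P`: the ball-averaged conserved fields of `Φ_t z` are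
`L²(𝕋³)`-close to `(ρ, ρu, E)(t)` in `P_N`-probability. At `t = 0` this is BLOCK STATICS. -/
def L2TrackingAt (P : Laws) {σ : ℝ} (Φ : Flows σ)
    (ρ : ℝ → T3 → ℝ) (u : ℝ → T3 → V3) (θ : ℝ → T3 → ℝ) (t : ℝ) : Prop :=
  ∀ δ : ℝ, 0 < δ →
    Tendsto (fun N : ℕ => P N
      {z | δ < ∫ x, ((bρ ((Φ N).flow t z) x - ρ t x) ^ 2
                    + ‖bm ((Φ N).flow t z) x - ρ t x • u t x‖ ^ 2
                    + (be ((Φ N).flow t z) x - totalEnergyDensity (ρ t x) (u t x) (θ t x)) ^ 2)})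
      atTop (𝓝 0)

/-- SUP-FORM BLOCK SECOND LAW on `[0, t]` under the laws `P`, in probability: the block entropy
never exceeds its initial value by more than `δ` anywhere on `[0,t]`, off sets of vanishing
probability. -/
def SecondLawSupAt (P : Laws) {σ : ℝ} (Φ : Flows σ) (t : ℝ) : Prop :=
  ∀ δ : ℝ, 0 < δ →
    Tendsto (fun N : ℕ => P N
      {z | ∃ r ∈ Icc 0 t, blockEntropy σ z + δ < blockEntropy σ ((Φ N).flow r z)})
      atTop (𝓝 0)

/-! ## Registered stubs (`Holds.stub_*`, bodies `sorry`) -/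

namespace Holds

/-- STUB 1 — PATH CONSISTENCY (part (ii) of the crux text; size M–L). From the mesoscopic ∀M cell
problem, the in-probability tail budget and the packing cap: there is `η̄ > 0` (the cell problem's
packing threshold) such that for every cap `η₀c ∈ (0, η̄]`, all continuous positive profiles, `σ`
small, every classical solution in the band `ρσ³ < η₀c/2` and every flow family with the `t = 0`
LLN, `PathConsistentAt LG Φ σ η₀c t` holds at every `t < T`. Proof plan: shrink the cell threshold
to `η₀c` (the guarded event only shrinks); `θe := 1 + sup θ₀` in `TransferInequality_holds`,
Cauchy–Schwarz `LG(S) ≤ (e^{C(N+1)} G(S))^{1/2}`, `M := C + 2` in `ExponentialCellProblem`; union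
over a polynomial grid of window starts in `[0,t]` plus a pathwise modulus of the defects in `s`;
`TailBudget` at `ηb := η₀c/2` and `NoDenseInclusions` at `η₁ := η₀c`, both at `t' := (t+T)/2`
(so `[0, t+τ_N] ⊆ [0,t']` eventually); on {tail ≤ δ' ∧ no over-packed ball} the cell guard holds
in every window. Why it might fail: the continuum of window starts needs a pathwise modulus of
`s ↦ Dmom(s), Den(s)` at polynomial scale (jumps at collisions are `O(ε‖∇ψ‖|Δv|/(N+1))`; fine
unless velocities are unbounded — the cubic guard bounds them only in `L³`-mass, not sup).
Sources: FengKurtz2006 Ch. 5–7; KipnisLandim1999 App. 1; stmt-14606, 14019, 14425, 9512, 9239. -/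
theorem stub_pathConsistency :
    ExponentialCellProblem → TailBudget → NoDenseInclusions →
      ∃ ηbar : ℝ, 0 < ηbar ∧ ∀ η₀c : ℝ, 0 < η₀c → η₀c ≤ ηbar →
        ∀ (a₀ θ₀ : T3 → ℝ) (u₀ : T3 → V3), Continuous a₀ → Continuous θ₀ → Continuous u₀ →
          (∀ x, 0 < a₀ x) → (∀ x, 0 < θ₀ x) →
          ∃ σ₀ : ℝ, 0 < σ₀ ∧ ∀ σ : ℝ, 0 < σ → σ < σ₀ →
            ∀ (T : ℝ) (ρ θ : ℝ → T3 → ℝ) (u : ℝ → T3 → V3), IsHardSphereEulerSolution σ T ρ u θ →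
              (∀ t ∈ Ico 0 T, ∀ x, ρ t x * σ ^ 3 < η₀c / 2) →
              ∀ Φ : Flows σ,
                TendstoHydroFieldsAt (fun N => localGibbsLaw σ a₀ u₀ θ₀ N (Φ N)) Φ ρ u θ 0 →
                ∀ t ∈ Ico 0 T,
                  PathConsistentAt (fun N => localGibbsLaw σ a₀ u₀ θ₀ N (Φ N)) Φ η₀c t := by
  sorry

/-- STUB 2 — BLOCK STATICS at `t = 0` (size L). Under the local Gibbs laws the ball-averaged
empirical fields at scale `ℓ_N = (N+1)^{-1/4}` (≈ `4.19 N^{1/4}` particles per ball) are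
`L²(𝕋³)`-close, in probability, to the `t = 0` data of any classical solution whose macroscopic
`t = 0` fields are the LLN limit of those laws (the hypothesis pins `(ρ, ρu, E)(0)` to the
equilibrium profile of `(a₀, u₀, θ₀)` at reduced diameter `σ`, both sides being continuous).
Static: low-activity cluster expansion / concentration of block occupation numbers at vanishing
radius, `N^{3/4}` balls, relative block fluctuation `N^{-1/8}`. Beyond the proved macroscopic
`localGibbs_lln` (fixed test functions). Why it might fail: uniform-in-`x` control of `N^{3/4}`
dependent blocks under the CANONICAL hard-sphere law needs decay of correlations at scale `ℓ_N`
with explicit `σ`-smallness; the identification of `ρ(0,·)` with the Gibbs density uses that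
`TendstoHydroFieldsAt … 0` determines continuous fields. Sources: Spohn1991 Part I Ch. 3;
Ruelle1969 §3.4–4; OllaVaradhanYau1993 §1; `Literature.MathematicalPhysics.KineticTheory.localGibbs_lln`. -/
theorem stub_blockStatics :
    ∀ (a₀ θ₀ : T3 → ℝ) (u₀ : T3 → V3), Continuous a₀ → Continuous θ₀ → Continuous u₀ →
      (∀ x, 0 < a₀ x) → (∀ x, 0 < θ₀ x) →
      ∃ σ₀ : ℝ, 0 < σ₀ ∧ ∀ σ : ℝ, 0 < σ → σ < σ₀ →
        ∀ (T : ℝ) (ρ θ : ℝ → T3 → ℝ) (u : ℝ → T3 → V3), IsHardSphereEulerSolution σ T ρ u θ →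
          0 < T → ∀ Φ : Flows σ,
            TendstoHydroFieldsAt (fun N => localGibbsLaw σ a₀ u₀ θ₀ N (Φ N)) Φ ρ u θ 0 →
            L2TrackingAt (fun N => localGibbsLaw σ a₀ u₀ θ₀ N (Φ N)) Φ ρ u θ 0 := by
  sorry

/-- STUB 3 — SUP-FORM BLOCK SECOND LAW under local Gibbs laws (size L; the entropy SELECTION input).
For continuous positive profiles, `σ` small, every flow family and every horizon `t ≥ 0`:
`LG_N{∃ r ∈ [0,t] : ∫η_σ(U^ℓ_N(r)) > ∫η_σ(U^ℓ_N(0)) + δ} → 0`. Mechanism (as for `ExpSecondLaw`,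
stmt-14608, whose typed form is the POINTWISE-in-`r` shadow of this statement, and for
`BlockEntropyBudget`, stmt-14427, its pointwise in-probability twin): `dLG/dG = e^{(N+1)Λ_N(U_N(0))}/𝒵`
with `Λ_N` linear in the time-0 block fields, conserved totals, `G` flow-invariant
(`GibbsInvariance_holds`), a static block-level LD upper bound under `G` with rate
`∫η_σ + linear` — the bound `LG(dip at r) ≤ poly(N)·e^{−(N+1)(δ − o(1))}` is UNIFORM in `r`
because `G(U(r) ≈ W) = G(U(0) ≈ W)`; a pathwise dip-persistence modulus (`|d/dr ∫ηB| ≲ N^{1/4}`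
given the conserved kinetic energy) and a union over an `N^{1/4+}`-point time grid give the sup
form. Why it might fail: the static block-LD upper bound for canonical hard spheres on `N^{3/4}`
balls with `o(N)` entropy correction is unprinted; empty/over-packed balls put `Real.log` and
`hsExcessFreeEnergy` on junk branches inside `ηB`, and the persistence modulus is false there.
Sources: KipnisLandim1999 Ch. 10; Georgii1994 Thm 2; Georgii1995 Thm 3.2; Varadhan2004ASEP;
OllaVaradhanYau1993; stmt-14608, stmt-14427. -/
theorem stub_secondLawSup :
    ∀ (a₀ θ₀ : T3 → ℝ) (u₀ : T3 → V3), Continuous a₀ → Continuous θ₀ → Continuous u₀ →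
      (∀ x, 0 < a₀ x) → (∀ x, 0 < θ₀ x) →
      ∃ σ₀ : ℝ, 0 < σ₀ ∧ ∀ σ : ℝ, 0 < σ → σ < σ₀ →
        ∀ Φ : Flows σ, ∀ t : ℝ, 0 ≤ t →
          SecondLawSupAt (fun N => localGibbsLaw σ a₀ u₀ θ₀ N (Φ N)) Φ t := by
  sorry

/-- STUB 4 — ENTROPIC CHARACTERISTICS (THE LEVER; size L). Entropy selection + finite-`N`
Dafermos / Březina–Feireisl relative-entropy weak–strong stability on the CAPPED DILUTE BRANCH:
there is `ηs > 0` (inside the analyticity band of `hsExcessFreeEnergy` given by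
`HsEosLowDensity_holds`, small enough for uniform convexity of `η_σ` in the conserved variables on
`{ρσ³ ≤ ηs}`) such that for every cap `η₀c ∈ (0, ηs]`, every `σ > 0`, every classical solution
`Ū = (ρ, ρu, E)` on `[0,T)` in the band `ρσ³ < η₀c/2`, every flow family and EVERY family of laws
`P_N` carried by the good sets: sup-form second law on every `[0,t]`, path consistency at cap
`η₀c` on every `[0,t]` (`t < T`) and `L²` tracking at `t = 0` imply `L²` tracking at every `t < T`.
Proof plan (deterministic on the good event, then monotonicity + subadditivity of `P_N`): relative
entropy `H(r) = ∫ η_σ(U^ℓ(r) | Ū(r)) dx` with tests `Dη_σ(Ū)` (smooth; smoothly clamped in time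
beyond `t' = (t+T)/2`), exact block mass balance, the windowed weak-form momentum/energy identities
with defects `≤ δ` per unit time, the entropy-flux compatibility cancelling the linear terms, flux
Taylor remainder `≤ C·(η_σ-Bregman)` on the capped branch (hot balls priced by the cubic tail),
global entropy budget `sup_r [∫η(U(r)) − ∫η(U(0))] ≤ δ`, `H(0) → 0` from `L²(0) → 0` (vacuum
excluded for `Ū` by positive continuous data; uniform integrability of `e^ℓ(0)`), Gronwall ⇒
`sup_{r ≤ t} H(r) → 0` ⇒ `L²(t) → 0` by uniform convexity near `Ū`. Why it might fail: (a) the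
Gronwall constants must not depend on the tail threshold `A` (warm capped balls: flux remainder
`∼ ρA³` vs Bregman `∼ ρA²/θ̄`), else the `∀ δ ∃ A` order of `PathConsistentAt` yields no smallness;
(b) near-vacuum BLOCKS (`ρ^ℓ → 0`, priced by neither cap) carry junk `Real.log 0` inside `η_σ`;
(c) a window-wise zero-defect, sup-entropy-admissible, capped mesoscopic path from smooth dilute
data that is NOT `L²`-close to `Ū` (wild admissible solutions exist for Euler:
ChiodaroliDeLellisKreml2015) refutes it. Sources: Dafermos1979; Dafermos2005 Thm 5.2.1 (p. 126);
BrezinaFeireisl2018 (arXiv:1702.04870) Thm 3.3; FengKurtz2006 ("classical solutions on a core");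
tree: `Literature/Analysis/PDE/ConservationLawWeakStrongStability.lean` (`Stability.relEntropy_ineq`). -/
theorem stub_entropicCharacteristics :
    ∃ ηs : ℝ, 0 < ηs ∧ ∀ η₀c : ℝ, 0 < η₀c → η₀c ≤ ηs →
      ∀ σ : ℝ, 0 < σ →
        ∀ (T : ℝ) (ρ θ : ℝ → T3 → ℝ) (u : ℝ → T3 → V3), IsHardSphereEulerSolution σ T ρ u θ →
          (∀ t ∈ Ico 0 T, ∀ x, ρ t x * σ ^ 3 < η₀c / 2) →
          ∀ (Φ : Flows σ) (P : Laws), (∀ N, P N ((Φ N).good)ᶜ = 0) →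
            (∀ t ∈ Ico 0 T, SecondLawSupAt P Φ t) →
            (∀ t ∈ Ico 0 T, PathConsistentAt P Φ η₀c t) →
            L2TrackingAt P Φ ρ u θ 0 →
            ∀ t ∈ Ico 0 T, L2TrackingAt P Φ ρ u θ t := by
  sorry

/-- STUB 5 — FIELD READ-OUT (size M; provable now in principle). For every `σ > 0`, classical
solution, flow family and family of laws carried by the good sets: `L²` tracking at a time
`t ∈ [0,T)` implies convergence in probability of the empirical fields tested against every
continuous `χ` (`TendstoHydroFieldsAt P Φ ρ u θ t`). Proof plan: `∫ χ ρ^ℓ = emp(χ̄^ℓ)` with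
`χ̄^ℓ` the ball average of `χ`, `‖χ̄^ℓ − χ‖_∞ ≤ ω_χ(ℓ_N) → 0` (uniform continuity on the compact
torus), so `|emp(χ) − ∫χρ_t| ≤ ω_χ(ℓ_N)·emp(1) + ‖χ‖_{L²}‖ρ^ℓ − ρ_t‖_{L²}`; momentum/energy alike
with the weights `|v|, |v|²/2` controlled by the total kinetic energy, itself within `o(1)` of
`∫E(t)` on the tracking event (energy component); continuity of `(ρ,u,θ)(t,·)` from the solution
class. Why it might fail: only through measurability/junk conventions (`empiricalMeasure` of
`N+1 ≥ 1` particles is a probability measure; `bρ, bm, be` are finite sums of indicators of open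
balls, `continuous_euclidDist`). Sources: OllaVaradhanYau1993 §1; Spohn1991 Part I Ch. 3;
`Literature.MathematicalPhysics.KineticTheory.TendstoHydroFieldsAt`. -/
theorem stub_fieldsOfTracking :
    ∀ σ : ℝ, 0 < σ →
      ∀ (T : ℝ) (ρ θ : ℝ → T3 → ℝ) (u : ℝ → T3 → V3), IsHardSphereEulerSolution σ T ρ u θ →
        ∀ (Φ : Flows σ) (P : Laws), (∀ N, P N ((Φ N).good)ᶜ = 0) →
          ∀ t ∈ Ico 0 T, L2TrackingAt P Φ ρ u θ t → TendstoHydroFieldsAt P Φ ρ u θ t := by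
  sorry

end Holds

/-! ## Stub statements by name (D-0027 §3.3: the hypotheses of `_of` are these `Prop`s) -/

/-- Statement of registered stub 1 (`Holds.stub_pathConsistency`), by name. -/
def stub_pathConsistency : Prop := type_of% Holds.stub_pathConsistency
/-- Statement of registered stub 2 (`Holds.stub_blockStatics`), by name. -/
def stub_blockStatics : Prop := type_of% Holds.stub_blockStatics
/-- Statement of registered stub 3 (`Holds.stub_secondLawSup`), by name. -/
def stub_secondLawSup : Prop := type_of% Holds.stub_secondLawSup
/-- Statement of registered stub 4 (`Holds.stub_entropicCharacteristics`), by name. -/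
def stub_entropicCharacteristics : Prop := type_of% Holds.stub_entropicCharacteristics
/-- Statement of registered stub 5 (`Holds.stub_fieldsOfTracking`), by name. -/
def stub_fieldsOfTracking : Prop := type_of% Holds.stub_fieldsOfTracking

/-! ## Sanity lemmas (sorry-free) -/

/-- The local Gibbs laws are carried by the good sets of the flows (`LG ≪ Liouville`, good is
Liouville-conull) — the side condition of stubs 4 and 5 for `P_N := localGibbsLaw …`. -/
theorem localGibbsLaw_compl_good (σ : ℝ) (a₀ θ₀ : T3 → ℝ) (u₀ : T3 → V3) (N : ℕ) (Φ : Flow σ N) :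
    localGibbsLaw σ a₀ u₀ θ₀ N Φ (Φ.good)ᶜ = 0 :=
  localGibbsLaw_absolutelyContinuous σ a₀ u₀ θ₀ N Φ Φ.measure_compl_good

/-- DOCKING NOTE for stub 3: its sup form implies, pointwise in `r`, the in-probability block second
law (the inner statement of `BlockEntropyBudget`, stmt-14427, up to the `z` vs `Φ_0 z` convention and
unfolding of the block functional) — recorded as the trivial specialisation `r ∈ [0, r]`. -/
theorem secondLawSupAt_pointwise {P : Laws} {σ : ℝ} {Φ : Flows σ} {r : ℝ} (hr : 0 ≤ r)
    (h : SecondLawSupAt P Φ r) (δ : ℝ) (hδ : 0 < δ) :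
    Tendsto (fun N : ℕ => P N
      {z | blockEntropy σ z + δ < blockEntropy σ ((Φ N).flow r z)}) atTop (𝓝 0) := by
  refine tendsto_of_tendsto_of_tendsto_of_le_of_le tendsto_const_nhds (h δ hδ)
    (fun N => zero_le) (fun N => ?_)
  exact measure_mono fun z hz => ⟨r, ⟨hr, le_rfl⟩, hz⟩

/-! ## Composition (sorry-free): the five stubs ⟹ the crux BY NAME -/

/-- **The skeleton theorem.** `η₀(HLIB) := η₀c/2` with `η₀c := min η̄ ηs`; per profile
`σ₀ := min σ₁ (min σ₂ σ₃)` from stubs 1, 2, 3; laws `P_N := localGibbsLaw σ a₀ u₀ θ₀ N (Φ N)`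
(carried by the good sets); then path consistency (1), block statics (2) and the sup second law (3)
feed the entropic stability (4), whose `L²` tracking at `t` is read out as `TendstoHydroFieldsAt`
(5). The crux antecedent `hS : ExpSecondLaw` is not consumed (see the file docstring, stub 3). -/
theorem FKTransferInProbR_of
    (h1 : stub_pathConsistency) (h2 : stub_blockStatics) (h3 : stub_secondLawSup)
    (h4 : stub_entropicCharacteristics) (h5 : stub_fieldsOfTracking) :
    Summit.AtomisticToContinuum.HydrodynamicLimit.Theses.EulerCharacteristics.FKTransferInProbR := by
  unfold Summit.AtomisticToContinuum.HydrodynamicLimit.Theses.EulerCharacteristics.FKTransferInProbR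
    Summit.AtomisticToContinuum.HydrodynamicLimit.Theses.EulerCharacteristics.HydroLimitInBand
  intro _hS hK hB hD
  obtain ⟨ηbar, hηbar, H1⟩ := (h1 : type_of% Holds.stub_pathConsistency) hK hB hD
  obtain ⟨ηs, hηs, H4⟩ := (h4 : type_of% Holds.stub_entropicCharacteristics)
  have H2 := (h2 : type_of% Holds.stub_blockStatics)
  have H3 := (h3 : type_of% Holds.stub_secondLawSup)
  have H5 := (h5 : type_of% Holds.stub_fieldsOfTracking)
  have hη₀c : 0 < min ηbar ηs := lt_min hηbar hηs
  refine ⟨min ηbar ηs / 2, half_pos hη₀c, ?_⟩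
  intro a₀ θ₀ u₀ ha hθ hu hap hθp
  obtain ⟨σ₁, hσ₁, K1⟩ := H1 (min ηbar ηs) hη₀c (min_le_left _ _) a₀ θ₀ u₀ ha hθ hu hap hθp
  obtain ⟨σ₂, hσ₂, K2⟩ := H2 a₀ θ₀ u₀ ha hθ hu hap hθp
  obtain ⟨σ₃, hσ₃, K3⟩ := H3 a₀ θ₀ u₀ ha hθ hu hap hθp
  refine ⟨min σ₁ (min σ₂ σ₃), lt_min hσ₁ (lt_min hσ₂ hσ₃), ?_⟩
  intro σ hσ hlt T ρ θ u hsol hband Φ h0 t ht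
  have h1lt : σ < σ₁ := lt_of_lt_of_le hlt (min_le_left _ _)
  have h2lt : σ < σ₂ := lt_of_lt_of_le hlt ((min_le_right _ _).trans (min_le_left _ _))
  have h3lt : σ < σ₃ := lt_of_lt_of_le hlt ((min_le_right _ _).trans (min_le_right _ _))
  have hT : 0 < T := lt_of_le_of_lt ht.1 ht.2
  -- the laws and their side condition
  have hgood : ∀ N, localGibbsLaw σ a₀ u₀ θ₀ N (Φ N) ((Φ N).good)ᶜ = 0 :=
    fun N => localGibbsLaw_compl_good σ a₀ θ₀ u₀ N (Φ N)
  -- (1) path consistency at cap `min ηbar ηs` on every `[0, t']`, `t' < T`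
  have hPC : ∀ t' ∈ Ico 0 T,
      PathConsistentAt (fun N => localGibbsLaw σ a₀ u₀ θ₀ N (Φ N)) Φ (min ηbar ηs) t' :=
    K1 σ hσ h1lt T ρ θ u hsol hband Φ h0
  -- (2) block statics at `t = 0`
  have hBS : L2TrackingAt (fun N => localGibbsLaw σ a₀ u₀ θ₀ N (Φ N)) Φ ρ u θ 0 :=
    K2 σ hσ h2lt T ρ θ u hsol hT Φ h0
  -- (3) sup-form second law on every `[0, t']`
  have hSL : ∀ t' ∈ Ico 0 T, SecondLawSupAt (fun N => localGibbsLaw σ a₀ u₀ θ₀ N (Φ N)) Φ t' :=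
    fun t' ht' => K3 σ hσ h3lt Φ t' ht'.1
  -- (4) entropic stability ⇒ L² tracking at `t`
  have hTr : L2TrackingAt (fun N => localGibbsLaw σ a₀ u₀ θ₀ N (Φ N)) Φ ρ u θ t :=
    H4 (min ηbar ηs) hη₀c (min_le_right _ _) σ hσ T ρ θ u hsol hband Φ
      (fun N => localGibbsLaw σ a₀ u₀ θ₀ N (Φ N)) hgood hSL hPC hBS t ht
  -- (5) read-out
  exact H5 σ hσ T ρ θ u hsol Φ (fun N => localGibbsLaw σ a₀ u₀ θ₀ N (Φ N)) hgood t ht hTr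

end Summit.AtomisticToContinuum.HydrodynamicLimit.Cruxes.FKTransferInProbR.Birth

end
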